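import Summits.ResolutionOfSingularities.ResolutionOfSingularities.Theorems.EquisingularLiftEquisingularLiftNatTowerSeedStageZero
import Summits.ResolutionOfSingularities.ResolutionOfSingularities.Theorems.EquisingularLiftEquisingularLiftNatTowerRoundBFiveClosure
import Summits.ResolutionOfSingularities.ResolutionOfSingularities.Theorems.EquisingularLiftEquisingularLiftNatTowerBFourPointStepsFEZero
import Summits.ResolutionOfSingularities.ResolutionOfSingularities.Theorems.EquisingularLiftEquisingularLiftNatTowerStageZeroCarrier
import Summits.ResolutionOfSingularities.ResolutionOfSingularities.Theorems.EquisingularLiftEquisingularLiftNatHostedEngineInit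
import HarnessLib

/-!
# [OURS · L1 W4.5(b) · EL♮(3) · WIDTH TABLE D17 «STAGE-0 TOWER BOOKKEEPING», engine (n5) modulo (T1)] HSUBⁱ AT DOOR τ0 `ReachTowerNose₀` FROM THE POINT-STEP CLOSURE —
# ★★ `Tower.hsubtower₀_of_ptReg₅`

res-L1-w45b-nose-w1 g7 (WIDTH seat D-0157 DOOR 1; desk RULING R82 (A) «(n5) `reachTowerNose₀_of_fact` + exit», R83 (3) «(n5) waits for E9′ + stub-4's (n1)/(n2)»).
Everything of the (n5) driver that does NOT read the body of the letter `TowerPtRegB₅` (re-typed in place as E9′ by res-type-027, desk R83): given the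
blob-E9 supplier binders at `(O, θ, φ)` and the door ✓ `ReachTowerNose₀ k 3 (Set.range ι) F₉ β T₉ E₉` (…DefsE9 p719436), instantiate its ∀R-clause with the
stage-0 motive `INV₀ G γ T E Es Ns K := Tower.InvB₄ O k θ ℙ³_O q Y Ch FE ℙ³_k Z₉ hZ₉ ℙ³_k (𝟙 _) G γ T E Es Ns K ∧ IsClosed K ∧ K ⊆ closure (K ∖ E) ∧ K ≠ univ` on
the stage-0 carrier ★ `Tower.exists_stage0Carrier` (p720711; `F₉ := F₁₀ := ℙ³_k`, `υ' := 𝟙`, `Z₉` a coordinate hyperplane), seed ✓ `Tower.invB₄_seed_stage0`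
(p719789), closures ✓ `Tower.towerPtRamB₄_invB₀_FE` (p720191) and ✓ `Tower.towerRoundB₅_invB₄_of_fact` (p719948, from (T-k) `EmbeddedCurveLiftFact`), the
(T1) closure `TowerPtRegB₅ ℙ³_k INV₀` TAKEN AS A HYPOTHESIS BY NAME (discharged in (n5) proper from res-L1-w45b-stub-4's `Tower.invB₄_ptRegStep₅`); exit by
✓ `Tower.invB₄_final` + ✓ `TCPlus.letterDatum_empty` (`E₉ = ∅` is the door's first conjunct) to the HSUBⁱ currency of ✓ `LiftNose.hsublift_of_door` VERBATIM.
Conditional on (T-k) only.  OURS; NOT a statement of any manuscript ([Hironaka2017] is a candidate under adjudication, nothing of it is asserted); AI-written,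
weaker than expert review.  DEF-FREE; no `sorry`; standard axioms.  `--kind proof --supports stmt-ResolutionOfSingularities-20148 --as helper`, counted 0.
EL♮(3) is NOT proved here.  [folklore; assembly of ✓ bricks]
-/

set_option linter.dupNamespace false -- mandated namespace `Summit.<Summit>.<Problem>` of this single-conjunct summit
set_option linter.overlappingInstances false -- signatures carry `[IsDomain O] [IsDiscreteValuationRing O]`

noncomputable section

open CategoryTheory CategoryTheory.Limits AlgebraicGeometry TopologicalSpace Topology IsLocalRing
open MvPolynomial
open Literature.AlgebraicGeometry.Resolution
open AlgebraicGeometry.Scheme.IdealSheafData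
open Summit.ResolutionOfSingularities.ResolutionOfSingularities.Theses.EquisingularLift.Split
open Summit.ResolutionOfSingularities.ResolutionOfSingularities.Cruxes.EquisingularLift.StrataSplit

namespace Summit.ResolutionOfSingularities.ResolutionOfSingularities.Cruxes.EquisingularLiftNat.Sections

/-- ★★ **HSUBⁱ at door τ0 `ReachTowerNose₀`, modulo the point-step closure (T1)** — see the module docstring. [OURS · L1 W4.5b · D17 engine (n5) modulo (T1);
counted 0; EL♮(3) NOT proved] -/
theorem Tower.hsubtower₀_of_ptReg₅ (hF : EmbeddedCurveLiftFact) (k : Type) [Field k] [IsAlgClosed k] (H : Scheme.{0})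
    (ι : H ⟶ (Literature.AlgebraicGeometry.Motives.projectiveSpace 3 k).left)
    (hι : AlgebraicGeometry.IsClosedImmersion ι) (hH : AlgebraicGeometry.IsIntegral H)
    (E₀ : Set (Literature.AlgebraicGeometry.Motives.projectiveSpace 3 k).left) :
    ∀ (O : Type) [CommRing O] [IsDomain O] [IsDiscreteValuationRing O] [IsAdicComplete (IsLocalRing.maximalIdeal O) O] [IsAlgClosed (IsLocalRing.ResidueField O)] (θ : O →+* k), Function.Surjective θ →
      (letI := MvPolynomial.gradedAlgebra (σ := Fin (3 + 1)) (R := O); letI := MvPolynomial.gradedAlgebra (σ := Fin (3 + 1)) (R := k);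
       ∀ (φ : MvPolynomial.homogeneousSubmodule (Fin (3 + 1)) O →+*ᵍ MvPolynomial.homogeneousSubmodule (Fin (3 + 1)) k)
        (hφ' : HomogeneousIdeal.irrelevant (MvPolynomial.homogeneousSubmodule (Fin (3 + 1)) k) ≤ (HomogeneousIdeal.irrelevant (MvPolynomial.homogeneousSubmodule (Fin (3 + 1)) O)).map φ), (∀ s, φ s = MvPolynomial.map θ s) →
      ∀ (Ch : ∀ X' : AlgebraicGeometry.Scheme.{0}, (X' ⟶ (AlgebraicGeometry.Proj (MvPolynomial.homogeneousSubmodule (Fin (3 + 1)) O))) → Set X' → Prop),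
        (∀ (X' X'' : AlgebraicGeometry.Scheme.{0}) (σ' : X' ⟶ (AlgebraicGeometry.Proj (MvPolynomial.homogeneousSubmodule (Fin (3 + 1)) O))) (S' : Set X') (C : X'.IdealSheafData) (τ : X'' ⟶ X'), Ch X' σ' S' → Literature.AlgebraicGeometry.Resolution.IsBlowup τ C →
          Literature.AlgebraicGeometry.Resolution.Scheme.IsRegular C.subscheme → AlgebraicGeometry.Flat (C.subschemeι ≫ σ' ≫ (AlgebraicGeometry.Proj.toSpecZero (MvPolynomial.homogeneousSubmodule (Fin (3 + 1)) O) ≫ AlgebraicGeometry.Spec.map (CommRingCat.ofHom (algebraMap O (MvPolynomial.homogeneousSubmodule (Fin (3 + 1)) O 0))))) → σ' '' (C.support : Set X') ⊆ {y | ¬ IsGenericPoint y (Set.range (ι ≫ AlgebraicGeometry.Proj.map φ hφ' : H ⟶ (AlgebraicGeometry.Proj (MvPolynomial.homogeneousSubmodule (Fin (3 + 1)) O))))} →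
          (C.support : Set X') ∩ (σ' ≫ (AlgebraicGeometry.Proj.toSpecZero (MvPolynomial.homogeneousSubmodule (Fin (3 + 1)) O) ≫ AlgebraicGeometry.Spec.map (CommRingCat.ofHom (algebraMap O (MvPolynomial.homogeneousSubmodule (Fin (3 + 1)) O 0))))) ⁻¹' {IsLocalRing.closedPoint O} ⊆ S' → Ch X'' (τ ≫ σ') (closure (τ ⁻¹' (S' \ (C.support : Set X'))))) → (∀ (X' : AlgebraicGeometry.Scheme.{0}) (σ' : X' ⟶ (AlgebraicGeometry.Proj (MvPolynomial.homogeneousSubmodule (Fin (3 + 1)) O))) (S' : Set X'), Ch X' σ' S' →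
          Summit.ResolutionOfSingularities.ResolutionOfSingularities.Theses.EquisingularLift.Split.Chain (AlgebraicGeometry.Proj (MvPolynomial.homogeneousSubmodule (Fin (3 + 1)) O)) (Set.range (ι ≫ AlgebraicGeometry.Proj.map φ hφ' : H ⟶ (AlgebraicGeometry.Proj (MvPolynomial.homogeneousSubmodule (Fin (3 + 1)) O)))) X' σ' S') → (Set.range (ι ≫ AlgebraicGeometry.Proj.map φ hφ' : H ⟶ (AlgebraicGeometry.Proj (MvPolynomial.homogeneousSubmodule (Fin (3 + 1)) O)))) ⊆ (AlgebraicGeometry.Proj.toSpecZero (MvPolynomial.homogeneousSubmodule (Fin (3 + 1)) O) ≫ AlgebraicGeometry.Spec.map (CommRingCat.ofHom (algebraMap O (MvPolynomial.homogeneousSubmodule (Fin (3 + 1)) O 0)))) ⁻¹' {IsLocalRing.closedPoint O} → IsIrreducible (Set.range (ι ≫ AlgebraicGeometry.Proj.map φ hφ' : H ⟶ (AlgebraicGeometry.Proj (MvPolynomial.homogeneousSubmodule (Fin (3 + 1)) O)))) → IsClosed (Set.range (ι ≫ AlgebraicGeometry.Proj.map φ hφ' : H ⟶ (AlgebraicGeometry.Proj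 (MvPolynomial.homogeneousSubmodule (Fin (3 + 1)) O)))) →
        AlgebraicGeometry.IsIntegral (AlgebraicGeometry.Proj (MvPolynomial.homogeneousSubmodule (Fin (3 + 1)) O)) → IsLocallyNoetherian (AlgebraicGeometry.Proj (MvPolynomial.homogeneousSubmodule (Fin (3 + 1)) O)) → Literature.AlgebraicGeometry.Resolution.Scheme.IsRegular (AlgebraicGeometry.Proj (MvPolynomial.homogeneousSubmodule (Fin (3 + 1)) O)) → AlgebraicGeometry.IsProper (AlgebraicGeometry.Proj.toSpecZero (MvPolynomial.homogeneousSubmodule (Fin (3 + 1)) O) ≫ AlgebraicGeometry.Spec.map (CommRingCat.ofHom (algebraMap O (MvPolynomial.homogeneousSubmodule (Fin (3 + 1)) O 0)))) → AlgebraicGeometry.SmoothOfRelativeDimension 3 (AlgebraicGeometry.Proj.toSpecZero (MvPolynomial.homogeneousSubmodule (Fin (3 + 1)) O) ≫ AlgebraicGeometry.Spec.map (CommRingCat.ofHom (algebraMap O (MvPolynomial.homogeneousSubmodule (Fin (3 + 1)) O 0)))) →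
      -- the INITIAL stage and the initial host's model
      Ch (AlgebraicGeometry.Proj (MvPolynomial.homogeneousSubmodule (Fin (3 + 1)) O)) (𝟙 (AlgebraicGeometry.Proj (MvPolynomial.homogeneousSubmodule (Fin (3 + 1)) O))) (Set.range (ι ≫ AlgebraicGeometry.Proj.map φ hφ' : H ⟶ (AlgebraicGeometry.Proj (MvPolynomial.homogeneousSubmodule (Fin (3 + 1)) O)))) →
      -- (T1) THE POINT-STEP CLOSURE of the re-typed `TowerPtRegB₅` (E9′) on the stage-0 motive `INV₀`, for every stage-0 carrier — discharged in (n5) proper by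
      -- res-L1-w45b-stub-4's `Tower.invB₄_ptRegStep₅` ((n1)/(n2)/(n2b)) + the K-side facts; BY NAME here, so this lemma is insensitive to the E9′ re-type
      (∀ (Z₉ : Set (Literature.AlgebraicGeometry.Motives.projectiveSpace 3 k).left) (hZ₉ : IsClosed Z₉),
        TowerPtRegB₅ (Literature.AlgebraicGeometry.Motives.projectiveSpace 3 k).left (fun G γ T E Es Ns K =>
          Tower.InvB₄ O k θ (AlgebraicGeometry.Proj (MvPolynomial.homogeneousSubmodule (Fin (3 + 1)) O)) (AlgebraicGeometry.Proj.toSpecZero (MvPolynomial.homogeneousSubmodule (Fin (3 + 1)) O) ≫ AlgebraicGeometry.Spec.map (CommRingCat.ofHom (algebraMap O (MvPolynomial.homogeneousSubmodule (Fin (3 + 1)) O 0)))) (Set.range (ι ≫ AlgebraicGeometry.Proj.map φ hφ' : H ⟶ (AlgebraicGeometry.Proj (MvPolynomial.homogeneousSubmodule (Fin (3 + 1)) O)))) Ch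
            (fun _ _ _ _ _ _ _ _ _ σ _ 𝓔 => Flat (𝓔.subschemeι ≫ σ ≫ (AlgebraicGeometry.Proj.toSpecZero (MvPolynomial.homogeneousSubmodule (Fin (3 + 1)) O) ≫ AlgebraicGeometry.Spec.map (CommRingCat.ofHom (algebraMap O (MvPolynomial.homogeneousSubmodule (Fin (3 + 1)) O 0))))))
            (Literature.AlgebraicGeometry.Motives.projectiveSpace 3 k).left Z₉ hZ₉ (Literature.AlgebraicGeometry.Motives.projectiveSpace 3 k).left (𝟙 _) G γ T E Es Ns K ∧ IsClosed K ∧ K ⊆ closure (K \ E) ∧ K ≠ Set.univ)) →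
      TCPlus.LetterDatum O (AlgebraicGeometry.Proj (MvPolynomial.homogeneousSubmodule (Fin (3 + 1)) O)) (AlgebraicGeometry.Proj.toSpecZero (MvPolynomial.homogeneousSubmodule (Fin (3 + 1)) O) ≫ AlgebraicGeometry.Spec.map (CommRingCat.ofHom (algebraMap O (MvPolynomial.homogeneousSubmodule (Fin (3 + 1)) O 0)))) (Set.range (ι ≫ AlgebraicGeometry.Proj.map φ hφ' : H ⟶ (AlgebraicGeometry.Proj (MvPolynomial.homogeneousSubmodule (Fin (3 + 1)) O)))) (Literature.AlgebraicGeometry.Motives.projectiveSpace 3 k).left (AlgebraicGeometry.Proj (MvPolynomial.homogeneousSubmodule (Fin (3 + 1)) O)) (𝟙 (AlgebraicGeometry.Proj (MvPolynomial.homogeneousSubmodule (Fin (3 + 1)) O))) (AlgebraicGeometry.Proj.map φ hφ' : (Literature.AlgebraicGeometry.Motives.projectiveSpace 3 k).left ⟶ (AlgebraicGeometry.Proj (MvPolynomial.homogeneousSubmodule (Fin (3 + 1)) O))) E₀ →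
      ∀ (ℓ : MvPolynomial (Fin (3 + 1)) k) (F₉ : AlgebraicGeometry.Scheme.{0}) (β : F₉ ⟶ (Literature.AlgebraicGeometry.Motives.projectiveSpace 3 k).left) (T₉ E₉ : Set F₉),
        E₀ = {y : (Literature.AlgebraicGeometry.Motives.projectiveSpace 3 k).left | ℓ ∈ (y : ProjectiveSpectrum (MvPolynomial.homogeneousSubmodule (Fin (3 + 1)) k)).asHomogeneousIdeal} →
        ReachTowerNose₀ k 3 (Set.range ι) F₉ β T₉ E₉ →
        ∃ (X₉ : AlgebraicGeometry.Scheme.{0}) (σ₉ : X₉ ⟶ (AlgebraicGeometry.Proj (MvPolynomial.homogeneousSubmodule (Fin (3 + 1)) O))) (S₉ : Set X₉) (j₉ : F₉ ⟶ X₉) (t₉ : F₉ ⟶ AlgebraicGeometry.Spec (.of k)),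
          Ch X₉ σ₉ S₉ ∧ AlgebraicGeometry.IsIntegral X₉ ∧ IsLocallyNoetherian X₉ ∧ Literature.AlgebraicGeometry.Resolution.Scheme.IsRegular X₉ ∧ AlgebraicGeometry.IsDominant (σ₉ ≫ (AlgebraicGeometry.Proj.toSpecZero (MvPolynomial.homogeneousSubmodule (Fin (3 + 1)) O) ≫ AlgebraicGeometry.Spec.map (CommRingCat.ofHom (algebraMap O (MvPolynomial.homogeneousSubmodule (Fin (3 + 1)) O 0))))) ∧
          IsPullback j₉ t₉ (σ₉ ≫ (AlgebraicGeometry.Proj.toSpecZero (MvPolynomial.homogeneousSubmodule (Fin (3 + 1)) O) ≫ AlgebraicGeometry.Spec.map (CommRingCat.ofHom (algebraMap O (MvPolynomial.homogeneousSubmodule (Fin (3 + 1)) O 0))))) (AlgebraicGeometry.Spec.map (CommRingCat.ofHom θ)) ∧ j₉ '' T₉ = S₉ ∧ IsClosed T₉ ∧ IsIrreducible T₉ ∧ AlgebraicGeometry.IsIntegral F₉ ∧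
          TCPlus.LetterDatum O (AlgebraicGeometry.Proj (MvPolynomial.homogeneousSubmodule (Fin (3 + 1)) O)) (AlgebraicGeometry.Proj.toSpecZero (MvPolynomial.homogeneousSubmodule (Fin (3 + 1)) O) ≫ AlgebraicGeometry.Spec.map (CommRingCat.ofHom (algebraMap O (MvPolynomial.homogeneousSubmodule (Fin (3 + 1)) O 0)))) (Set.range (ι ≫ AlgebraicGeometry.Proj.map φ hφ' : H ⟶ (AlgebraicGeometry.Proj (MvPolynomial.homogeneousSubmodule (Fin (3 + 1)) O)))) F₉ X₉ σ₉ j₉ E₉) := by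
  classical
  intro O _ _ _ _ _ θ hθ
  letI := MvPolynomial.gradedAlgebra (σ := Fin (3 + 1)) (R := O)
  letI := MvPolynomial.gradedAlgebra (σ := Fin (3 + 1)) (R := k)
  intro φ hφ' hφ Ch hChStep hChSplit hYsp hYirr hYcl hPint hPnoeth hPreg hqprop hqsm hCh₀ hT1 _h𝓔₀ _ℓ F₉ β T₉ E₉ _hE hR
  obtain ⟨hE₉, E', Es', Ns', K', hcl⟩ := hR
  subst hE₉
  haveI := hPint
  haveI := hqprop
  haveI := hqsm
  -- the stage-0 carrier (`F₉ := F₁₀ := ℙ³_k`, `υ' := 𝟙`): a coordinate hyperplane (★ `Tower.exists_stage0Carrier`)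
  have hcar : ∃ (Z₉ : Set (Literature.AlgebraicGeometry.Motives.projectiveSpace 3 k).left) (hZ₉ : IsClosed Z₉),
      IsBlowup (𝟙 (Literature.AlgebraicGeometry.Motives.projectiveSpace 3 k).left) (vanishingIdeal (⟨Z₉, hZ₉⟩ : Closeds _)) ∧ Z₉.Infinite := Tower.exists_stage0Carrier k 1
  obtain ⟨Z₉, hZ₉, hυ', hZ₉inf⟩ := hcar
  -- the motive `INV₀` and its seed ((n3) ✓ `Tower.invB₄_seed_stage0`)
  have hseed : (fun G γ T E Es Ns K =>
          Tower.InvB₄ O k θ (AlgebraicGeometry.Proj (MvPolynomial.homogeneousSubmodule (Fin (3 + 1)) O)) (AlgebraicGeometry.Proj.toSpecZero (MvPolynomial.homogeneousSubmodule (Fin (3 + 1)) O) ≫ AlgebraicGeometry.Spec.map (CommRingCat.ofHom (algebraMap O (MvPolynomial.homogeneousSubmodule (Fin (3 + 1)) O 0)))) (Set.range (ι ≫ AlgebraicGeometry.Proj.map φ hφ' : H ⟶ (AlgebraicGeometry.Proj (MvPolynomial.homogeneousSubmodule (Fin (3 + 1)) O)))) Ch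
            (fun _ _ _ _ _ _ _ _ _ σ _ 𝓔 => Flat (𝓔.subschemeι ≫ σ ≫ (AlgebraicGeometry.Proj.toSpecZero (MvPolynomial.homogeneousSubmodule (Fin (3 + 1)) O) ≫ AlgebraicGeometry.Spec.map (CommRingCat.ofHom (algebraMap O (MvPolynomial.homogeneousSubmodule (Fin (3 + 1)) O 0))))))
            (Literature.AlgebraicGeometry.Motives.projectiveSpace 3 k).left Z₉ hZ₉ (Literature.AlgebraicGeometry.Motives.projectiveSpace 3 k).left (𝟙 _) G γ T E Es Ns K ∧ IsClosed K ∧ K ⊆ closure (K \ E) ∧ K ≠ Set.univ) (Literature.AlgebraicGeometry.Motives.projectiveSpace 3 k).left (𝟙 _) (Set.range ι) ∅ [] [] ∅ :=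
    Tower.invB₄_seed_stage0 k H ι hι hH O θ hθ φ hφ' hφ Ch hPint hPnoeth hPreg hCh₀ (Literature.AlgebraicGeometry.Motives.projectiveSpace 3 k).left Z₉ hZ₉ (𝟙 _) hυ' hZ₉inf
  -- the three closures of door τ0: (T1) by hypothesis, `TowerPtRamB₄` (✓ `Tower.towerPtRamB₄_invB₀_FE`), (T2) (✓ `Tower.towerRoundB₅_invB₄_of_fact`)
  have hptram : TowerPtRamB₄ (Literature.AlgebraicGeometry.Motives.projectiveSpace 3 k).left (fun G γ T E Es Ns K =>
          Tower.InvB₄ O k θ (AlgebraicGeometry.Proj (MvPolynomial.homogeneousSubmodule (Fin (3 + 1)) O)) (AlgebraicGeometry.Proj.toSpecZero (MvPolynomial.homogeneousSubmodule (Fin (3 + 1)) O) ≫ AlgebraicGeometry.Spec.map (CommRingCat.ofHom (algebraMap O (MvPolynomial.homogeneousSubmodule (Fin (3 + 1)) O 0)))) (Set.range (ι ≫ AlgebraicGeometry.Proj.map φ hφ' : H ⟶ (AlgebraicGeometry.Proj (MvPolynomial.homogeneousSubmodule (Fin (3 + 1)) O)))) Ch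
            (fun _ _ _ _ _ _ _ _ _ σ _ 𝓔 => Flat (𝓔.subschemeι ≫ σ ≫ (AlgebraicGeometry.Proj.toSpecZero (MvPolynomial.homogeneousSubmodule (Fin (3 + 1)) O) ≫ AlgebraicGeometry.Spec.map (CommRingCat.ofHom (algebraMap O (MvPolynomial.homogeneousSubmodule (Fin (3 + 1)) O 0))))))
            (Literature.AlgebraicGeometry.Motives.projectiveSpace 3 k).left Z₉ hZ₉ (Literature.AlgebraicGeometry.Motives.projectiveSpace 3 k).left (𝟙 _) G γ T E Es Ns K ∧ IsClosed K ∧ K ⊆ closure (K \ E) ∧ K ≠ Set.univ) :=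
    Tower.towerPtRamB₄_invB₀_FE O k θ hθ (AlgebraicGeometry.Proj (MvPolynomial.homogeneousSubmodule (Fin (3 + 1)) O)) (AlgebraicGeometry.Proj.toSpecZero (MvPolynomial.homogeneousSubmodule (Fin (3 + 1)) O) ≫ AlgebraicGeometry.Spec.map (CommRingCat.ofHom (algebraMap O (MvPolynomial.homogeneousSubmodule (Fin (3 + 1)) O 0)))) (Set.range (ι ≫ AlgebraicGeometry.Proj.map φ hφ' : H ⟶ (AlgebraicGeometry.Proj (MvPolynomial.homogeneousSubmodule (Fin (3 + 1)) O)))) hYsp hYirr hYcl hPnoeth hPreg Ch hChStep hChSplit (Literature.AlgebraicGeometry.Motives.projectiveSpace 3 k).left Z₉ hZ₉ (Literature.AlgebraicGeometry.Motives.projectiveSpace 3 k).left (𝟙 _)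
  have hround : TowerRoundB₅ (Literature.AlgebraicGeometry.Motives.projectiveSpace 3 k).left (fun G γ T E Es Ns K =>
          Tower.InvB₄ O k θ (AlgebraicGeometry.Proj (MvPolynomial.homogeneousSubmodule (Fin (3 + 1)) O)) (AlgebraicGeometry.Proj.toSpecZero (MvPolynomial.homogeneousSubmodule (Fin (3 + 1)) O) ≫ AlgebraicGeometry.Spec.map (CommRingCat.ofHom (algebraMap O (MvPolynomial.homogeneousSubmodule (Fin (3 + 1)) O 0)))) (Set.range (ι ≫ AlgebraicGeometry.Proj.map φ hφ' : H ⟶ (AlgebraicGeometry.Proj (MvPolynomial.homogeneousSubmodule (Fin (3 + 1)) O)))) Ch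
            (fun _ _ _ _ _ _ _ _ _ σ _ 𝓔 => Flat (𝓔.subschemeι ≫ σ ≫ (AlgebraicGeometry.Proj.toSpecZero (MvPolynomial.homogeneousSubmodule (Fin (3 + 1)) O) ≫ AlgebraicGeometry.Spec.map (CommRingCat.ofHom (algebraMap O (MvPolynomial.homogeneousSubmodule (Fin (3 + 1)) O 0))))))
            (Literature.AlgebraicGeometry.Motives.projectiveSpace 3 k).left Z₉ hZ₉ (Literature.AlgebraicGeometry.Motives.projectiveSpace 3 k).left (𝟙 _) G γ T E Es Ns K ∧ IsClosed K ∧ K ⊆ closure (K \ E) ∧ K ≠ Set.univ) :=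
    Tower.towerRoundB₅_invB₄_of_fact O k θ hθ (AlgebraicGeometry.Proj (MvPolynomial.homogeneousSubmodule (Fin (3 + 1)) O)) (AlgebraicGeometry.Proj.toSpecZero (MvPolynomial.homogeneousSubmodule (Fin (3 + 1)) O) ≫ AlgebraicGeometry.Spec.map (CommRingCat.ofHom (algebraMap O (MvPolynomial.homogeneousSubmodule (Fin (3 + 1)) O 0)))) (Set.range (ι ≫ AlgebraicGeometry.Proj.map φ hφ' : H ⟶ (AlgebraicGeometry.Proj (MvPolynomial.homogeneousSubmodule (Fin (3 + 1)) O)))) hYsp hYirr hYcl hPnoeth hPreg Ch hChStep hChSplit (hF k O θ hθ _ _) Z₉ hZ₉ (𝟙 _)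
  -- the door's ∀R-clause at `R := INV₀`, then the exit ✓ `Tower.invB₄_final` and the empty host's letter datum
  have h' := hcl (fun G γ T E Es Ns K =>
          Tower.InvB₄ O k θ (AlgebraicGeometry.Proj (MvPolynomial.homogeneousSubmodule (Fin (3 + 1)) O)) (AlgebraicGeometry.Proj.toSpecZero (MvPolynomial.homogeneousSubmodule (Fin (3 + 1)) O) ≫ AlgebraicGeometry.Spec.map (CommRingCat.ofHom (algebraMap O (MvPolynomial.homogeneousSubmodule (Fin (3 + 1)) O 0)))) (Set.range (ι ≫ AlgebraicGeometry.Proj.map φ hφ' : H ⟶ (AlgebraicGeometry.Proj (MvPolynomial.homogeneousSubmodule (Fin (3 + 1)) O)))) Ch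
            (fun _ _ _ _ _ _ _ _ _ σ _ 𝓔 => Flat (𝓔.subschemeι ≫ σ ≫ (AlgebraicGeometry.Proj.toSpecZero (MvPolynomial.homogeneousSubmodule (Fin (3 + 1)) O) ≫ AlgebraicGeometry.Spec.map (CommRingCat.ofHom (algebraMap O (MvPolynomial.homogeneousSubmodule (Fin (3 + 1)) O 0))))))
            (Literature.AlgebraicGeometry.Motives.projectiveSpace 3 k).left Z₉ hZ₉ (Literature.AlgebraicGeometry.Motives.projectiveSpace 3 k).left (𝟙 _) G γ T E Es Ns K ∧ IsClosed K ∧ K ⊆ closure (K \ E) ∧ K ≠ Set.univ) hseed (hT1 Z₉ hZ₉) hptram hround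
  obtain ⟨X₉, σ₉, S₉, j₉, t₉, h1, h2, h3, h4, h5, h6, h7, h8, h9, h10⟩ :=
    Tower.invB₄_final O k θ (AlgebraicGeometry.Proj (MvPolynomial.homogeneousSubmodule (Fin (3 + 1)) O)) (AlgebraicGeometry.Proj.toSpecZero (MvPolynomial.homogeneousSubmodule (Fin (3 + 1)) O) ≫ AlgebraicGeometry.Spec.map (CommRingCat.ofHom (algebraMap O (MvPolynomial.homogeneousSubmodule (Fin (3 + 1)) O 0)))) (Set.range (ι ≫ AlgebraicGeometry.Proj.map φ hφ' : H ⟶ (AlgebraicGeometry.Proj (MvPolynomial.homogeneousSubmodule (Fin (3 + 1)) O)))) Ch (fun _ _ _ _ _ _ _ _ _ σ _ 𝓔 => Flat (𝓔.subschemeι ≫ σ ≫ (AlgebraicGeometry.Proj.toSpecZero (MvPolynomial.homogeneousSubmodule (Fin (3 + 1)) O) ≫ AlgebraicGeometry.Spec.map (CommRingCat.ofHom (algebraMap O (MvPolynomial.homogeneousSubmodule (Fin (3 + 1)) O 0)))))) (Literature.AlgebraicGeometry.Motives.projectiveSpace 3 k).left Z₉ hZ₉ (Literature.AlgebraicGeometry.Motives.projectiveSpace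 3 k).left (𝟙 _) F₉ β T₉ E' Es' Ns' K' h'.1
  exact ⟨X₉, σ₉, S₉, j₉, t₉, h1, h2, h3, h4, h5, h6, h7, h8, h9, h10, TCPlus.letterDatum_empty O _ _ _ F₉ X₉ σ₉ j₉⟩

end Summit.ResolutionOfSingularities.ResolutionOfSingularities.Cruxes.EquisingularLiftNat.Sections

end
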